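import Literature.AlgebraicGeometry.Resolution.AdicQuotient
import Mathlib.RingTheory.AdicCompletion.Completeness
import Mathlib.RingTheory.AdicCompletion.LocalRing
import Mathlib.RingTheory.TensorProduct.Basic
import Mathlib.RingTheory.Localization.AtPrime.Basic
import Mathlib.RingTheory.Localization.Ideal
import HarnessLib

/-!
# Completing an algebra commutes with completing the base: `C^_𝔫 ≅ (R' ⊗_R C)^_𝔫`

Topic: `Literature/AlgebraicGeometry/Resolution`. Infrastructure for the formal-local analysis of
blow-ups (de Jong 1996, 4.27: the completed local rings of a blow-up `X' → X` at the closed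
points over a closed point `x` are computed on the blow-up of `Spec 𝒪̂_{X,x}`; file
`AlterationsNormalFormBlowupChartsReduction.lean`). The principle proved here, in pure
commutative algebra: if `R → R'` induces isomorphisms `R/𝔭ⁿ ≅ R'/𝔭ⁿR'` for all `n` — as do
the `𝔭`-adic completion `R → R^` (`𝔭` finitely generated, Stacks 05GG), the localisation
`R → R_𝔭` at a maximal ideal, and their composite `R → (R_𝔭)^` — then for every `R`-algebra
`C` and every ideal `𝔫 ⊇ 𝔭C` of `C`, the map `c ↦ 1 ⊗ c` induces isomorphisms
`C/𝔫ᵏ ≅ (R' ⊗_R C)/𝔫ᵏ(R' ⊗_R C)` for all `k`, hence an isomorphism of adic completions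
`C^_𝔫 ≅ (R' ⊗_R C)^_{𝔫(R' ⊗_R C)}`, and `𝔫(R' ⊗_R C)` is maximal when `𝔫` is. Everything is
PROVED; there are no named facts.

* `adicCompletionMap_bijective_of_quotientMap`, `adicCompletionEquivOfQuotientMap` — a ring map
  `f : S → S₂` with `f(I) ⊆ I₂` whose level maps `S/Iⁿ → S₂/I₂ⁿ` are all bijective induces an
  isomorphism `S^_I ≅ S₂^_{I₂}` (`adicCompletionMap` of `AdicQuotient.lean`; the inverse is the
  limit of the inverted levels, Mathlib's `AdicCompletion.liftRingHom`).
* `quotientMap_injective_iff_forall`, `quotientMap_surjective_iff_forall` — membership forms of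
  injectivity/surjectivity of `A/J → B/JB`.
* `tensorInr R R' C : C → R' ⊗_R C`; `tensorToQuot` — the retraction
  `λₙ : R' ⊗_R C → C/𝔭ⁿC`, `r' ⊗ c ↦ σₙ(r') c̄` with `σₙ : R' → R'/𝔭ⁿR' ≅ R/𝔭ⁿ → C/𝔭ⁿC`;
  `exists_sub_tensorInr_mem` (every tensor is `≡ 1 ⊗ c mod 𝔫ᵏ`), `mem_pow_of_tensorInr_mem`
  (`1 ⊗ c ∈ 𝔫ᵏ(R' ⊗ C) ⇒ c ∈ 𝔫ᵏ`, via `λₖ`), `quotientMap_pow_tensorInr_bijective`;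
  **`completionTensorBaseEquiv`** and `isMaximal_map_tensorInr`.
* Level-bijective maps: `quotientMap_pow_bijective_adicCompletion` (Stacks 05GG, through
  Mathlib's `AdicCompletion.pow_smul_top_eq_ker_eval`; `mem_map_pow_adicCompletion_iff`),
  `quotientMap_pow_bijective_of_isLocalization` (`𝔭` maximal, any `IsLocalization.AtPrime`,
  through Mathlib's `IsLocalization.AtPrime.equivQuotMaximalIdealPow`),
  `quotientMap_pow_bijective_trans` (towers `R → R' → R''`).

## Sources

* The Stacks Project, Tag 05GG (`Ker(M^ → M/IⁿM) = IⁿM^` for `I` finitely generated).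
  [StacksProject]
* H. Matsumura, *Commutative Ring Theory*, CUP 1986, §8 (Thm. 8.7, 8.11: completion and base
  change / quotients), for the circle of ideas; the statements here are folklore.
-/

noncomputable section

namespace Literature.AlgebraicGeometry.Resolution

universe u

open AdicCompletion TensorProduct

/-! ## A criterion for a map of adic completions to be an isomorphism -/

section Criterion

variable {S : Type u} [CommRing S] {S₂ : Type u} [CommRing S₂] (I : Ideal S) (I₂ : Ideal S₂)
  (f : S →+* S₂) (h : I.map f ≤ I₂)

/-- The level maps `S/Iⁿ → S₂/I₂ⁿ` commute with the transition maps. [folklore] -/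
theorem factorPow_quotientMap {m n : ℕ} (hle : m ≤ n) (z : S ⧸ I ^ n) :
    Ideal.Quotient.factorPow I₂ hle
        (Ideal.quotientMap (I₂ ^ n) f (pow_le_comap_pow_of_map_le f h n) z) =
      Ideal.quotientMap (I₂ ^ m) f (pow_le_comap_pow_of_map_le f h m)
        (Ideal.Quotient.factorPow I hle z) := by
  obtain ⟨s, rfl⟩ := Ideal.Quotient.mk_surjective z
  rfl

/-- If all level maps `S/Iⁿ → S₂/I₂ⁿ` are injective, so is `S^_I → S₂^_{I₂}`. [folklore] -/
theorem adicCompletionMap_injective_of_quotientMap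
    (hb : ∀ n, Function.Injective
      (Ideal.quotientMap (I₂ ^ n) f (pow_le_comap_pow_of_map_le f h n))) :
    Function.Injective (adicCompletionMap I I₂ f h) := by
  intro x y hxy
  refine AdicCompletion.ext_evalₐ fun n => hb n ?_
  have := congrArg (evalₐ I₂ n) hxy
  rwa [evalₐ_adicCompletionMap, evalₐ_adicCompletionMap] at this

/-- If all level maps `S/Iⁿ → S₂/I₂ⁿ` are bijective, the inverses `S₂^ → S₂/I₂ⁿ ≅ S/Iⁿ` form a
compatible family. [folklore] -/
theorem factorPow_comp_symm_evalₐ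
    (hb : ∀ n, Function.Bijective
      (Ideal.quotientMap (I₂ ^ n) f (pow_le_comap_pow_of_map_le f h n))) {m n : ℕ} (hle : m ≤ n) :
    (Ideal.Quotient.factorPow I hle).comp
        ((RingEquiv.ofBijective _ (hb n)).symm.toRingHom.comp (evalₐ I₂ n).toRingHom) =
      (RingEquiv.ofBijective _ (hb m)).symm.toRingHom.comp (evalₐ I₂ m).toRingHom := by
  ext y
  apply (RingEquiv.ofBijective _ (hb m)).injective
  change RingEquiv.ofBijective _ (hb m) (Ideal.Quotient.factorPow I hle
      ((RingEquiv.ofBijective _ (hb n)).symm (evalₐ I₂ n y))) =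
    RingEquiv.ofBijective _ (hb m) ((RingEquiv.ofBijective _ (hb m)).symm (evalₐ I₂ m y))
  rw [RingEquiv.apply_symm_apply, RingEquiv.ofBijective_apply, ← factorPow_quotientMap I I₂ f h hle,
    ← RingEquiv.ofBijective_apply _ (hb n), RingEquiv.apply_symm_apply, factorPow_evalₐ]

/-- **If all level maps `S/Iⁿ → S₂/I₂ⁿ` are bijective, then `S^_I → S₂^_{I₂}` is bijective.**
[folklore] -/
theorem adicCompletionMap_bijective_of_quotientMap
    (hb : ∀ n, Function.Bijective
      (Ideal.quotientMap (I₂ ^ n) f (pow_le_comap_pow_of_map_le f h n))) :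
    Function.Bijective (adicCompletionMap I I₂ f h) := by
  refine ⟨adicCompletionMap_injective_of_quotientMap I I₂ f h fun n => (hb n).1, fun y => ?_⟩
  refine ⟨AdicCompletion.liftRingHom I
    (fun n => (RingEquiv.ofBijective _ (hb n)).symm.toRingHom.comp (evalₐ I₂ n).toRingHom)
    (fun hle => factorPow_comp_symm_evalₐ I I₂ f h hb hle) y, ?_⟩
  refine AdicCompletion.ext_evalₐ fun n => ?_
  rw [evalₐ_adicCompletionMap, AdicCompletion.evalₐ_liftRingHom]
  change RingEquiv.ofBijective _ (hb n) ((RingEquiv.ofBijective _ (hb n)).symm (evalₐ I₂ n y)) = _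
  rw [RingEquiv.apply_symm_apply]

/-- The isomorphism of completions induced by a map with bijective level maps. [folklore] -/
def adicCompletionEquivOfQuotientMap
    (hb : ∀ n, Function.Bijective
      (Ideal.quotientMap (I₂ ^ n) f (pow_le_comap_pow_of_map_le f h n))) :
    AdicCompletion I S ≃+* AdicCompletion I₂ S₂ :=
  RingEquiv.ofBijective _ (adicCompletionMap_bijective_of_quotientMap I I₂ f h hb)

/-- `adicCompletionEquivOfQuotientMap` extends `f`. [folklore] -/
@[simp]
theorem adicCompletionEquivOfQuotientMap_of
    (hb : ∀ n, Function.Bijective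
      (Ideal.quotientMap (I₂ ^ n) f (pow_le_comap_pow_of_map_le f h n))) (s : S) :
    adicCompletionEquivOfQuotientMap I I₂ f h hb (of I S s) = of I₂ S₂ (f s) :=
  adicCompletionMap_of I I₂ f h s

end Criterion

/-! ## Level maps: membership characterisations -/

section Levels

variable {A : Type u} [CommRing A] {B : Type u} [CommRing B] (g : A →+* B) (J : Ideal A)

/-- `A/J → B/JB` is injective iff `g⁻¹(JB) ⊆ J`. [folklore] -/
theorem quotientMap_injective_iff_forall :
    Function.Injective (Ideal.quotientMap (J.map g) g Ideal.le_comap_map) ↔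
      ∀ a : A, g a ∈ J.map g → a ∈ J := by
  rw [injective_iff_map_eq_zero]
  constructor
  · intro h a ha
    have := h (Ideal.Quotient.mk J a) (by
      rw [Ideal.quotientMap_mk]; exact Ideal.Quotient.eq_zero_iff_mem.mpr ha)
    exact Ideal.Quotient.eq_zero_iff_mem.mp this
  · intro h z hz
    obtain ⟨a, rfl⟩ := Ideal.Quotient.mk_surjective z
    rw [Ideal.quotientMap_mk] at hz
    exact Ideal.Quotient.eq_zero_iff_mem.mpr (h a (Ideal.Quotient.eq_zero_iff_mem.mp hz))

/-- `A/J → B/JB` is surjective iff every element of `B` is congruent to an element of `g(A)`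
modulo `JB`. [folklore] -/
theorem quotientMap_surjective_iff_forall :
    Function.Surjective (Ideal.quotientMap (J.map g) g Ideal.le_comap_map) ↔
      ∀ b : B, ∃ a : A, b - g a ∈ J.map g := by
  constructor
  · intro h b
    obtain ⟨z, hz⟩ := h (Ideal.Quotient.mk _ b)
    obtain ⟨a, rfl⟩ := Ideal.Quotient.mk_surjective z
    rw [Ideal.quotientMap_mk] at hz
    exact ⟨a, (Ideal.Quotient.mk_eq_mk_iff_sub_mem _ _).mp hz.symm⟩
  · intro h z
    obtain ⟨b, rfl⟩ := Ideal.Quotient.mk_surjective z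
    obtain ⟨a, ha⟩ := h b
    exact ⟨Ideal.Quotient.mk J a, by
      rw [Ideal.quotientMap_mk]; exact ((Ideal.Quotient.mk_eq_mk_iff_sub_mem _ _).mpr ha).symm⟩

end Levels

/-! ## Base change along a map which is bijective on the levels `R/𝔭ⁿ` -/

section BaseChange

variable {R : Type u} [CommRing R] {R' : Type u} [CommRing R'] [Algebra R R'] (𝔭 : Ideal R)
  (hR' : ∀ n, Function.Bijective
    (Ideal.quotientMap ((𝔭 ^ n).map (algebraMap R R')) (algebraMap R R') Ideal.le_comap_map))
  (C : Type u) [CommRing C] [Algebra R C]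

variable (R R') in
/-- The structure map `C → R' ⊗_R C`, `c ↦ 1 ⊗ c`, as a ring homomorphism. [folklore] -/
def tensorInr : C →+* R' ⊗[R] C :=
  (Algebra.TensorProduct.includeRight : C →ₐ[R] R' ⊗[R] C).toRingHom

variable (R R') {C} in
/-- Unfolding `tensorInr`. [folklore] -/
@[simp]
theorem tensorInr_apply (c : C) : tensorInr R R' C c = (1 : R') ⊗ₜ[R] c := rfl

variable (R R') in
/-- `C → R' ⊗_R C` is compatible with the structure maps from `R`. [folklore] -/
theorem tensorInr_comp_algebraMap :
    (tensorInr R R' C).comp (algebraMap R C) = algebraMap R (R' ⊗[R] C) :=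
  (Algebra.TensorProduct.includeRight : C →ₐ[R] R' ⊗[R] C).comp_algebraMap

variable {C}

/-- The level isomorphism `R/𝔭ⁿ ≅ R'/𝔭ⁿR'` as an `R`-algebra isomorphism. [folklore] -/
def baseQuotEquiv (n : ℕ) : (R ⧸ 𝔭 ^ n) ≃ₐ[R] R' ⧸ (𝔭 ^ n).map (algebraMap R R') :=
  AlgEquiv.ofBijective
    (Ideal.quotientMapₐ ((𝔭 ^ n).map (algebraMap R R')) (Algebra.ofId R R') Ideal.le_comap_map)
    (hR' n)

/-- Unfolding `baseQuotEquiv` on residue classes from `R`. [folklore] -/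
theorem baseQuotEquiv_mk (n : ℕ) (r : R) :
    baseQuotEquiv 𝔭 hR' n (Ideal.Quotient.mk _ r) = Ideal.Quotient.mk _ (algebraMap R R' r) :=
  rfl

/-- The map `R' → R'/𝔭ⁿR' ≅ R/𝔭ⁿ → C/𝔭ⁿC` of `R`-algebras. [folklore] -/
def baseToQuot (n : ℕ) : R' →ₐ[R] C ⧸ (𝔭 ^ n).map (algebraMap R C) :=
  (Ideal.quotientMapₐ ((𝔭 ^ n).map (algebraMap R C)) (Algebra.ofId R C) Ideal.le_comap_map).comp
    (((baseQuotEquiv 𝔭 hR' n).symm : (R' ⧸ (𝔭 ^ n).map (algebraMap R R')) →ₐ[R] R ⧸ 𝔭 ^ n).comp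
      (Ideal.Quotient.mkₐ R ((𝔭 ^ n).map (algebraMap R R'))))

/-- The map `λₙ : R' ⊗_R C → C/𝔭ⁿC`, `r' ⊗ c ↦ σₙ(r') · c̄`. [folklore] -/
def tensorToQuot (n : ℕ) : R' ⊗[R] C →ₐ[R] C ⧸ (𝔭 ^ n).map (algebraMap R C) :=
  Algebra.TensorProduct.lift (baseToQuot 𝔭 hR' n) (Ideal.Quotient.mkₐ R _)
    fun _ _ => Commute.all _ _

/-- `λₙ(1 ⊗ c) = c̄`. [folklore] -/
theorem tensorToQuot_tensorInr (n : ℕ) (c : C) :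
    tensorToQuot 𝔭 hR' n (tensorInr R R' C c) = Ideal.Quotient.mk _ c := by
  rw [tensorInr_apply, tensorToQuot, Algebra.TensorProduct.lift_tmul, map_one, one_mul]
  rfl

/-- `λₙ ∘ (c ↦ 1 ⊗ c)` is the quotient map. [folklore] -/
theorem tensorToQuot_comp_tensorInr (n : ℕ) :
    (tensorToQuot 𝔭 hR' n).toRingHom.comp (tensorInr R R' C) =
      Ideal.Quotient.mk ((𝔭 ^ n).map (algebraMap R C)) :=
  RingHom.ext fun c => tensorToQuot_tensorInr 𝔭 hR' n c

variable (𝔫 : Ideal C) (h𝔫 : 𝔭.map (algebraMap R C) ≤ 𝔫)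

include h𝔫 in
/-- `𝔭ᵏ C ⊆ 𝔫ᵏ` when `𝔭C ⊆ 𝔫`. [folklore] -/
theorem map_pow_le_pow (k : ℕ) : (𝔭 ^ k).map (algebraMap R C) ≤ 𝔫 ^ k := by
  rw [Ideal.map_pow]
  exact Ideal.pow_right_mono h𝔫 k

include h𝔫 in
/-- `𝔭ᵏ (R' ⊗_R C) ⊆ 𝔫ᵏ (R' ⊗_R C)`. [folklore] -/
theorem map_pow_algebraMap_tensor_le (k : ℕ) :
    (𝔭 ^ k).map (algebraMap R (R' ⊗[R] C)) ≤ (𝔫 ^ k).map (tensorInr R R' C) := by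
  rw [← tensorInr_comp_algebraMap R R', ← Ideal.map_map]
  exact Ideal.map_mono (map_pow_le_pow 𝔭 𝔫 h𝔫 k)

include hR' in
/-- Every `r' ∈ R'` is congruent to an element of `R` modulo `𝔭ᵏ R'`. [folklore] -/
theorem exists_sub_algebraMap_mem_map_pow (k : ℕ) (r' : R') :
    ∃ r : R, r' - algebraMap R R' r ∈ (𝔭 ^ k).map (algebraMap R R') :=
  (quotientMap_surjective_iff_forall (algebraMap R R') (𝔭 ^ k)).mp (hR' k).2 r'

include hR' h𝔫 in
/-- **Surjectivity on levels**: every element of `R' ⊗_R C` is congruent to some `1 ⊗ c`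
modulo `𝔫ᵏ (R' ⊗_R C)`. [folklore] -/
theorem exists_sub_tensorInr_mem (k : ℕ) (t : R' ⊗[R] C) :
    ∃ c : C, t - tensorInr R R' C c ∈ (𝔫 ^ k).map (tensorInr R R' C) := by
  induction t using TensorProduct.induction_on with
  | zero => exact ⟨0, by rw [_root_.map_zero, sub_zero]; exact Ideal.zero_mem _⟩
  | tmul r' c =>
    obtain ⟨r, hr⟩ := exists_sub_algebraMap_mem_map_pow 𝔭 hR' k r'
    refine ⟨r • c, ?_⟩
    have e : r' ⊗ₜ[R] c - tensorInr R R' C (r • c) =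
        ((r' - algebraMap R R' r) ⊗ₜ[R] (1 : C)) * ((1 : R') ⊗ₜ[R] c) := by
      rw [Algebra.TensorProduct.tmul_mul_tmul, one_mul, mul_one, TensorProduct.sub_tmul,
        tensorInr_apply, TensorProduct.tmul_smul, TensorProduct.smul_tmul',
        Algebra.algebraMap_eq_smul_one]
    rw [e]
    refine Ideal.mul_mem_right _ _ (map_pow_algebraMap_tensor_le 𝔭 𝔫 h𝔫 k ?_)
    have hmem : (Algebra.TensorProduct.includeLeft : R' →ₐ[R] R' ⊗[R] C).toRingHom
        (r' - algebraMap R R' r) ∈ ((𝔭 ^ k).map (algebraMap R R')).map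
          (Algebra.TensorProduct.includeLeft : R' →ₐ[R] R' ⊗[R] C).toRingHom :=
      Ideal.mem_map_of_mem _ hr
    rw [Ideal.map_map, AlgHom.toRingHom_eq_coe, AlgHom.comp_algebraMap] at hmem
    exact hmem
  | add x y hx hy =>
    obtain ⟨c₁, h₁⟩ := hx
    obtain ⟨c₂, h₂⟩ := hy
    refine ⟨c₁ + c₂, ?_⟩
    have e : x + y - tensorInr R R' C (c₁ + c₂) =
        (x - tensorInr R R' C c₁) + (y - tensorInr R R' C c₂) := by
      rw [_root_.map_add]; ring
    rw [e]
    exact Ideal.add_mem _ h₁ h₂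

include hR' h𝔫 in
/-- **Injectivity on levels**: if `1 ⊗ c ∈ 𝔫ᵏ (R' ⊗_R C)` then `c ∈ 𝔫ᵏ` (apply `λₖ`).
[folklore] -/
theorem mem_pow_of_tensorInr_mem (k : ℕ) {c : C}
    (hc : tensorInr R R' C c ∈ (𝔫 ^ k).map (tensorInr R R' C)) : c ∈ 𝔫 ^ k := by
  have h1 : (tensorToQuot 𝔭 hR' k).toRingHom (tensorInr R R' C c) ∈
      ((𝔫 ^ k).map (tensorInr R R' C)).map (tensorToQuot 𝔭 hR' k).toRingHom :=
    Ideal.mem_map_of_mem _ hc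
  rw [Ideal.map_map, tensorToQuot_comp_tensorInr] at h1
  have h2 : Ideal.Quotient.mk ((𝔭 ^ k).map (algebraMap R C)) c ∈
      (𝔫 ^ k).map (Ideal.Quotient.mk ((𝔭 ^ k).map (algebraMap R C))) := by
    rw [← tensorToQuot_tensorInr 𝔭 hR' k c]
    exact h1
  rw [← Ideal.mem_comap, Ideal.comap_map_of_surjective _ Ideal.Quotient.mk_surjective,
    ← RingHom.ker_eq_comap_bot, Ideal.mk_ker, sup_eq_left.mpr (map_pow_le_pow 𝔭 𝔫 h𝔫 k)] at h2
  exact h2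

include hR' h𝔫 in
/-- **The level maps `C/𝔫ᵏ → (R' ⊗_R C)/𝔫ᵏ(R' ⊗_R C)` are bijective.** [folklore] -/
theorem quotientMap_pow_tensorInr_bijective (k : ℕ) :
    Function.Bijective (Ideal.quotientMap ((𝔫.map (tensorInr R R' C)) ^ k) (tensorInr R R' C)
      (pow_le_comap_pow_of_map_le (tensorInr R R' C) le_rfl k)) := by
  have hpow : (𝔫.map (tensorInr R R' C)) ^ k = (𝔫 ^ k).map (tensorInr R R' C) :=
    (Ideal.map_pow _ _ k).symm
  constructor
  · refine Ideal.quotientMap_injective' fun x hx => ?_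
    rw [Ideal.mem_comap, hpow] at hx
    exact mem_pow_of_tensorInr_mem 𝔭 hR' 𝔫 h𝔫 k hx
  · intro z
    obtain ⟨t, rfl⟩ := Ideal.Quotient.mk_surjective z
    obtain ⟨c, hc⟩ := exists_sub_tensorInr_mem 𝔭 hR' 𝔫 h𝔫 k t
    refine ⟨Ideal.Quotient.mk _ c, ?_⟩
    rw [Ideal.quotientMap_mk]
    rw [← hpow] at hc
    exact ((Ideal.Quotient.mk_eq_mk_iff_sub_mem _ _).mpr hc).symm

/-- **Completing an algebra at an ideal over `𝔭` commutes with base change along a map which is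
bijective on all levels `R/𝔭ⁿ → R'/𝔭ⁿR'`** (e.g. `R' = R^_𝔭`, or the completion of `R_𝔭` for
`𝔭` maximal): for an `R`-algebra `C` and an ideal `𝔫 ⊇ 𝔭C`, `c ↦ 1 ⊗ c` induces
`C^_𝔫 ≅ (R' ⊗_R C)^_{𝔫(R' ⊗_R C)}`. [folklore] -/
def completionTensorBaseEquiv :
    AdicCompletion 𝔫 C ≃+* AdicCompletion (𝔫.map (tensorInr R R' C)) (R' ⊗[R] C) :=
  adicCompletionEquivOfQuotientMap 𝔫 _ (tensorInr R R' C) le_rfl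
    (quotientMap_pow_tensorInr_bijective 𝔭 hR' 𝔫 h𝔫)

/-- `completionTensorBaseEquiv` extends `c ↦ 1 ⊗ c`. [folklore] -/
@[simp]
theorem completionTensorBaseEquiv_of (c : C) :
    completionTensorBaseEquiv 𝔭 hR' 𝔫 h𝔫 (of 𝔫 C c) = of _ (R' ⊗[R] C) ((1 : R') ⊗ₜ[R] c) :=
  adicCompletionEquivOfQuotientMap_of 𝔫 _ (tensorInr R R' C) le_rfl _ c

include hR' h𝔫 in
/-- The extended ideal `𝔫 (R' ⊗_R C)` is maximal if `𝔫` is: the level-one map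
`C/𝔫 → (R' ⊗_R C)/𝔫(R' ⊗_R C)` is bijective. [folklore] -/
theorem isMaximal_map_tensorInr [h : 𝔫.IsMaximal] :
    (𝔫.map (tensorInr R R' C)).IsMaximal := by
  have hb := quotientMap_pow_tensorInr_bijective 𝔭 hR' 𝔫 h𝔫 1
  let e : (C ⧸ 𝔫 ^ 1) ≃+* (R' ⊗[R] C) ⧸ (𝔫.map (tensorInr R R' C)) ^ 1 :=
    RingEquiv.ofBijective _ hb
  have h1 : (𝔫 ^ 1).IsMaximal := by rwa [pow_one]
  have hf : IsField ((R' ⊗[R] C) ⧸ (𝔫.map (tensorInr R R' C)) ^ 1) :=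
    MulEquiv.isField ((Ideal.Quotient.maximal_ideal_iff_isField_quotient _).mp h1) e.symm.toMulEquiv
  have := Ideal.Quotient.maximal_of_isField _ hf
  rwa [pow_one] at this

end BaseChange

/-! ## Maps which are bijective on the levels `R/𝔭ⁿ` -/

section Instances

variable {R : Type u} [CommRing R] (𝔭 : Ideal R)

/-- Membership in `𝔭ⁿ R^` is tested on the `n`-th level: `x ∈ 𝔭ⁿR^ ↔ evalₙ(x) = 0`, for `𝔭`
finitely generated (Stacks 05GG: `Ker(R^ → R/𝔭ⁿ) = 𝔭ⁿR^`). [cite: StacksProject, Tag 05GG] -/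
theorem mem_map_pow_adicCompletion_iff (h𝔭 : 𝔭.FG) (n : ℕ) (x : AdicCompletion 𝔭 R) :
    x ∈ (𝔭 ^ n).map (algebraMap R (AdicCompletion 𝔭 R)) ↔ evalₐ 𝔭 n x = 0 := by
  have hle : 𝔭 ^ n ≤ 𝔭 ^ n • ⊤ := le_of_eq (by simp [Ideal.mul_top])
  have hinj : Function.Injective (Ideal.Quotient.factor hle) := by
    rw [RingHom.injective_iff_ker_eq_bot, Ideal.Quotient.factor_ker]
    exact Ideal.map_mk_eq_bot_of_le (le_of_eq (by simp [Ideal.mul_top]))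
  rw [← Submodule.restrictScalars_mem R, ← Ideal.smul_top_eq_map, pow_smul_top_eq_ker_eval h𝔭,
    LinearMap.mem_ker, ← factor_evalₐ_eq_eval 𝔭 x hle, map_eq_zero_iff _ hinj]

/-- **The adic completion is bijective on levels**: `R/𝔭ⁿ ≅ R^/𝔭ⁿR^` for `𝔭` finitely
generated. [cite: StacksProject, Tag 05GG] -/
theorem quotientMap_pow_bijective_adicCompletion (h𝔭 : 𝔭.FG) (n : ℕ) :
    Function.Bijective (Ideal.quotientMap ((𝔭 ^ n).map (algebraMap R (AdicCompletion 𝔭 R)))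
      (algebraMap R (AdicCompletion 𝔭 R)) Ideal.le_comap_map) := by
  constructor
  · rw [quotientMap_injective_iff_forall]
    intro a ha
    rw [mem_map_pow_adicCompletion_iff 𝔭 h𝔭, AdicCompletion.algebraMap_apply,
      Algebra.algebraMap_self, RingHom.id_apply, evalₐ_of, Ideal.Quotient.eq_zero_iff_mem] at ha
    exact ha
  · rw [quotientMap_surjective_iff_forall]
    intro x
    obtain ⟨a, ha⟩ := Ideal.Quotient.mk_surjective (evalₐ 𝔭 n x)
    refine ⟨a, ?_⟩
    rw [mem_map_pow_adicCompletion_iff 𝔭 h𝔭, map_sub, AdicCompletion.algebraMap_apply,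
      Algebra.algebraMap_self, RingHom.id_apply, evalₐ_of, ha, sub_self]

/-- **Localising at a maximal ideal is bijective on levels**: `R/𝔭ⁿ ≅ R_𝔭/𝔭ⁿR_𝔭` for `𝔭`
maximal (`R/𝔭ⁿ` is already local; Mathlib's `IsLocalization.AtPrime.equivQuotMaximalIdealPow`).
[folklore] -/
theorem quotientMap_pow_bijective_of_isLocalization [𝔭.IsMaximal] (S : Type u) [CommRing S]
    [Algebra R S] [IsLocalization.AtPrime S 𝔭] (n : ℕ) :
    Function.Bijective (Ideal.quotientMap ((𝔭 ^ n).map (algebraMap R S)) (algebraMap R S)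
      Ideal.le_comap_map) := by
  haveI : IsLocalRing S := IsLocalization.AtPrime.isLocalRing S 𝔭
  have hmap : (𝔭 ^ n).map (algebraMap R S) = IsLocalRing.maximalIdeal S ^ n := by
    rw [Ideal.map_pow, IsLocalization.AtPrime.map_eq_maximalIdeal 𝔭 S]
  let e := IsLocalization.AtPrime.equivQuotMaximalIdealPow 𝔭 S n
  constructor
  · rw [quotientMap_injective_iff_forall]
    intro a ha
    rw [hmap, ← Ideal.Quotient.eq_zero_iff_mem,
      ← IsLocalization.AtPrime.equivQuotMaximalIdealPow_apply_mk 𝔭 S n,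
      map_eq_zero_iff _ e.injective, Ideal.Quotient.eq_zero_iff_mem] at ha
    exact ha
  · rw [quotientMap_surjective_iff_forall]
    intro s
    obtain ⟨a, ha⟩ := Ideal.Quotient.mk_surjective (e.symm (Ideal.Quotient.mk _ s))
    refine ⟨a, ?_⟩
    have h1 : Ideal.Quotient.mk (IsLocalRing.maximalIdeal S ^ n) (algebraMap R S a) =
        Ideal.Quotient.mk _ s := by
      rw [← IsLocalization.AtPrime.equivQuotMaximalIdealPow_apply_mk 𝔭 S n, ha,
        AlgEquiv.apply_symm_apply]
    rw [hmap]
    exact (Ideal.Quotient.mk_eq_mk_iff_sub_mem _ _).mp h1.symm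

/-- Along a tower `R → R' → R''`, the extension of `𝔭ⁿ` to `R''` is the extension of
`(𝔭R')ⁿ`. [folklore] -/
theorem map_pow_eq_map_map_pow {R' R'' : Type u} [CommRing R'] [CommRing R''] [Algebra R R']
    [Algebra R' R''] [Algebra R R''] [IsScalarTower R R' R''] (n : ℕ) :
    (𝔭 ^ n).map (algebraMap R R'') = ((𝔭.map (algebraMap R R')) ^ n).map (algebraMap R' R'') := by
  rw [← Ideal.map_pow, Ideal.map_map, ← IsScalarTower.algebraMap_eq]

/-- **Level-bijectivity is transitive**: if `R → R'` is bijective on the levels `R/𝔭ⁿ` and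
`R' → R''` on the levels `R'/(𝔭R')ⁿ`, then `R → R''` is bijective on the levels `R/𝔭ⁿ`.
[folklore] -/
theorem quotientMap_pow_bijective_trans {R' R'' : Type u} [CommRing R'] [CommRing R'']
    [Algebra R R'] [Algebra R' R''] [Algebra R R''] [IsScalarTower R R' R'']
    (h1 : ∀ n, Function.Bijective (Ideal.quotientMap ((𝔭 ^ n).map (algebraMap R R'))
      (algebraMap R R') Ideal.le_comap_map))
    (h2 : ∀ n, Function.Bijective (Ideal.quotientMap
      (((𝔭.map (algebraMap R R')) ^ n).map (algebraMap R' R'')) (algebraMap R' R'')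
        Ideal.le_comap_map)) (n : ℕ) :
    Function.Bijective (Ideal.quotientMap ((𝔭 ^ n).map (algebraMap R R'')) (algebraMap R R'')
      Ideal.le_comap_map) := by
  have hpow : (𝔭.map (algebraMap R R')) ^ n = (𝔭 ^ n).map (algebraMap R R') :=
    (Ideal.map_pow _ _ n).symm
  constructor
  · rw [quotientMap_injective_iff_forall]
    intro a ha
    rw [map_pow_eq_map_map_pow 𝔭 (R' := R') n, IsScalarTower.algebraMap_apply R R' R''] at ha
    have h2' := (quotientMap_injective_iff_forall _ _).mp (h2 n).1 _ ha
    rw [hpow] at h2'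
    exact (quotientMap_injective_iff_forall _ _).mp (h1 n).1 _ h2'
  · rw [quotientMap_surjective_iff_forall]
    intro b''
    obtain ⟨b', hb'⟩ := (quotientMap_surjective_iff_forall _ _).mp (h2 n).2 b''
    obtain ⟨a, ha⟩ := (quotientMap_surjective_iff_forall _ _).mp (h1 n).2 b'
    refine ⟨a, ?_⟩
    have e : b'' - algebraMap R R'' a =
        (b'' - algebraMap R' R'' b') + algebraMap R' R'' (b' - algebraMap R R' a) := by
      rw [map_sub, ← IsScalarTower.algebraMap_apply R R' R'']
      ring
    rw [e]
    refine Ideal.add_mem _ ?_ ?_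
    · rw [map_pow_eq_map_map_pow 𝔭 (R' := R') n]
      exact hb'
    · have := Ideal.mem_map_of_mem (algebraMap R' R'') ha
      rwa [Ideal.map_map, ← IsScalarTower.algebraMap_eq] at this

end Instances

end Literature.AlgebraicGeometry.Resolution

end
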